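import Summits.Ventures.PercRepro.ThetaMultiHalves

/-!
# (Θ_∞) relative to a ground set: the projection at a point and the partner family

Dossier proofs/MINE1-theoremS.md, Addendum 73–74 (mine-1, gen 38). The ground-set induction for
(Θ_∞) projects an instance at a point `e`; the projected instance lives on the smaller ground set
`U ∖ e`, so the family has to be formed with complements **relative to a ground set** `U`:
`complsRel U A = {U ∖ t : t ∈ A}`, `crossDRel U A B = A ⊼ B ∪ complsRel U (A ⊻ B)`,
`multiDRel U A` and `MultiValidRel U A` (members inside `U`, the `2m` families pairwise disjoint).
For `U = univ` these are the absolute notions of ThetaMulti.lean (`multiDRel_univ`,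
`multiValidRel_univ`).

**The projection at `e`.** `projE e A i = {x ∖ e : x ∈ A i}` and the **partner family**
`partE e A i = {x ∈ A i : e ∉ x, x + e ∈ A i}` (the pairs of `A i` that merge under the
projection). This file holds the definitions, the membership lemmas, the erase identities, the
count `card_projE_add_card_partE` (`|projE e A i| + |partE e A i| = |A i|`), and the validity
transport: `multiValidRel_partE` (the partner instance of a valid instance is valid) and
`multiValidRel_projE` (the projected instance is valid when no partner pair is
**label-inconsistent** — `ConsistentAt`: no two members of different classes differ exactly in `e`,
and no two members are complementary in `U ∖ e`; Addendum 73's configurations (i)–(iii)). The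
projection step itself is ThetaMultiProjStep.lean.
-/

namespace PercRepro.MSTight

open Finset
open scoped FinsetFamily

variable {α : Type*} [DecidableEq α] [Fintype α]
variable {ι : Type*} [DecidableEq ι] [Fintype ι]

section RelDefs

/-- Complements relative to the ground set `U`. -/
def complsRel (U : Finset α) (A : Finset (Finset α)) : Finset (Finset α) := A.image fun t => U \ t

/-- The cross term relative to `U`: meets and relative co-joins. -/
def crossDRel (U : Finset α) (A B : Finset (Finset α)) : Finset (Finset α) :=
  A ⊼ B ∪ complsRel U (A ⊻ B)

/-- The multi-class difference family relative to the ground set `U`. -/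
def multiDRel (U : Finset α) (A : ι → Finset (Finset α)) : Finset (Finset α) :=
  {∅} ∪ univ.biUnion (fun i => A i \\ A i) ∪
    (univ.filter fun p : ι × ι => p.1 ≠ p.2).biUnion fun p => crossDRel U (A p.1) (A p.2)

/-- Validity relative to `U`: members inside `U`, the families and their relative complement
families pairwise disjoint. -/
def MultiValidRel (U : Finset α) (A : ι → Finset (Finset α)) : Prop :=
  (∀ i, ∀ x ∈ A i, x ⊆ U) ∧ (∀ i, Disjoint (A i) (complsRel U (A i))) ∧
    ∀ i j, i ≠ j → Disjoint (A i) (A j) ∧ Disjoint (A i) (complsRel U (A j))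

/-- The projection of the classes at `e`. -/
def projE (e : α) (A : ι → Finset (Finset α)) : ι → Finset (Finset α) :=
  fun i => (A i).image fun x => x.erase e

/-- The partner family at `e`: the members avoiding `e` whose `e`-partner is in the same class. -/
def partE (e : α) (A : ι → Finset (Finset α)) : ι → Finset (Finset α) :=
  fun i => (A i).filter fun x => e ∉ x ∧ insert e x ∈ A i

/-- Label-consistency of the projection at `e`: no two members of different classes differ exactly
in `e`, and no two members are complementary inside `U ∖ e`. -/
def ConsistentAt (U : Finset α) (e : α) (A : ι → Finset (Finset α)) : Prop :=
  (∀ i j, ∀ x ∈ A i, ∀ y ∈ A j, x.erase e = y.erase e → i = j) ∧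
    ∀ i j, ∀ x ∈ A i, ∀ y ∈ A j, (U.erase e) \ x.erase e ≠ y.erase e

omit [Fintype α] in
/-- Membership in a relative complement family. -/
theorem mem_complsRel {U : Finset α} {A : Finset (Finset α)} {E : Finset α} :
    E ∈ complsRel U A ↔ ∃ t ∈ A, U \ t = E := by
  unfold complsRel
  simp only [mem_image]

omit [Fintype α] in
/-- Membership in the relative cross term. -/
theorem mem_crossDRel {U : Finset α} {A B : Finset (Finset α)} {E : Finset α} :
    E ∈ crossDRel U A B ↔
      (∃ x ∈ A, ∃ y ∈ B, x ⊓ y = E) ∨ ∃ x ∈ A, ∃ y ∈ B, U \ (x ⊔ y) = E := by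
  unfold crossDRel
  rw [mem_union, mem_infs, mem_complsRel]
  constructor
  · rintro (h | ⟨t, ht, rfl⟩)
    · exact Or.inl h
    · rw [mem_sups] at ht
      obtain ⟨x, hx, y, hy, rfl⟩ := ht
      exact Or.inr ⟨x, hx, y, hy, rfl⟩
  · rintro (h | ⟨x, hx, y, hy, rfl⟩)
    · exact Or.inl h
    · exact Or.inr ⟨x ⊔ y, sup_mem_sups hx hy, rfl⟩

omit [Fintype α] in
/-- Membership in the relative multi-class family. -/
theorem mem_multiDRel {U : Finset α} {A : ι → Finset (Finset α)} {E : Finset α} :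
    E ∈ multiDRel U A ↔
      E = ∅ ∨ (∃ i, E ∈ A i \\ A i) ∨ ∃ i j, i ≠ j ∧ E ∈ crossDRel U (A i) (A j) := by
  unfold multiDRel
  simp only [mem_union, mem_singleton, mem_biUnion, mem_univ, true_and, mem_filter, Prod.exists,
    or_assoc]

omit [Fintype α] in
/-- `∅` is a relative multi-class difference. -/
theorem empty_mem_multiDRel (U : Finset α) (A : ι → Finset (Finset α)) : ∅ ∈ multiDRel U A :=
  mem_multiDRel.2 (Or.inl rfl)

omit [Fintype α] in
/-- Within-class differences are relative multi-class differences. -/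
theorem mem_multiDRel_of_mem_diffs {U : Finset α} {A : ι → Finset (Finset α)} {E : Finset α}
    (i : ι) (h : E ∈ A i \\ A i) : E ∈ multiDRel U A :=
  mem_multiDRel.2 (Or.inr (Or.inl ⟨i, h⟩))

omit [Fintype α] in
/-- Cross meets are relative multi-class differences. -/
theorem inf_mem_multiDRel {U : Finset α} {A : ι → Finset (Finset α)} {i j : ι} (hij : i ≠ j)
    {x y : Finset α} (hx : x ∈ A i) (hy : y ∈ A j) : x ⊓ y ∈ multiDRel U A :=
  mem_multiDRel.2 (Or.inr (Or.inr ⟨i, j, hij, mem_crossDRel.2 (Or.inl ⟨x, hx, y, hy, rfl⟩)⟩))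

omit [Fintype α] in
/-- Relative cross co-joins are relative multi-class differences. -/
theorem sdiff_sup_mem_multiDRel {U : Finset α} {A : ι → Finset (Finset α)} {i j : ι} (hij : i ≠ j)
    {x y : Finset α} (hx : x ∈ A i) (hy : y ∈ A j) : U \ (x ⊔ y) ∈ multiDRel U A :=
  mem_multiDRel.2 (Or.inr (Or.inr ⟨i, j, hij, mem_crossDRel.2 (Or.inr ⟨x, hx, y, hy, rfl⟩)⟩))

/-- Relative to the full ground set, the relative complement family is the complement family. -/
theorem complsRel_univ (A : Finset (Finset α)) : complsRel univ A = compls A := rfl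

/-- Relative to the full ground set, the relative family is `multiD`. -/
theorem multiDRel_univ (A : ι → Finset (Finset α)) : multiDRel univ A = multiD A := rfl

omit [DecidableEq ι] [Fintype ι] in
/-- Relative to the full ground set, relative validity is validity. -/
theorem multiValidRel_univ (A : ι → Finset (Finset α)) :
    MultiValidRel univ A ↔ MultiValid A := by
  unfold MultiValidRel MultiValid
  simp only [subset_univ, implies_true, true_and, complsRel_univ]

end RelDefs

section ProjBasics

variable {U : Finset α} {e : α} {A : ι → Finset (Finset α)}

omit [Fintype α] [DecidableEq ι] [Fintype ι] in
/-- Membership in a projected class. -/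
theorem mem_projE {i : ι} {z : Finset α} : z ∈ projE e A i ↔ ∃ x ∈ A i, x.erase e = z := by
  unfold projE
  simp only [mem_image]

omit [Fintype α] [DecidableEq ι] [Fintype ι] in
/-- Membership in a partner class. -/
theorem mem_partE {i : ι} {z : Finset α} : z ∈ partE e A i ↔ z ∈ A i ∧ e ∉ z ∧ insert e z ∈ A i := by
  unfold partE
  simp only [mem_filter]

omit [Fintype α] in
/-- The three erase identities behind the step. -/
theorem erase_sdiff_erase' (x y : Finset α) : x.erase e \ y.erase e = (x \ y).erase e := by
  ext a
  simp only [mem_sdiff, mem_erase]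
  tauto

omit [Fintype α] in
/-- Erasing `e` commutes with meets. -/
theorem erase_inf_erase' (x y : Finset α) : x.erase e ⊓ y.erase e = (x ⊓ y).erase e := by
  ext a
  simp only [inf_eq_inter, mem_inter, mem_erase]
  tauto

omit [Fintype α] in
/-- Erasing `e` commutes with relative co-joins. -/
theorem erase_sdiff_sup_erase' (U x y : Finset α) :
    U.erase e \ (x.erase e ⊔ y.erase e) = (U \ (x ⊔ y)).erase e := by
  ext a
  simp only [sup_eq_union, mem_sdiff, mem_erase, mem_union]
  tauto

end ProjBasics

section ProjCount

variable {e : α} {A : ι → Finset (Finset α)}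

omit [Fintype α] [DecidableEq ι] [Fintype ι] in
/-- `|projE e A i| + |partE e A i| = |A i|`: the projection identifies exactly the partner pairs. -/
theorem card_projE_add_card_partE (i : ι) :
    (projE e A i).card + (partE e A i).card = (A i).card := by
  classical
  -- split `A i` into the members avoiding `e` and those containing it
  set A0 := (A i).filter fun x => e ∉ x with hA0
  set A1 := (A i).filter fun x => e ∈ x with hA1
  have hcard : (A i).card = A0.card + A1.card := by
    rw [hA0, hA1, add_comm, card_filter_add_card_filter_not]
  -- the projection is `A0 ∪ image A1`, the image of `A1` has the size of `A1`
  have himg : projE e A i = A0 ∪ A1.image fun x => x.erase e := by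
    ext z
    rw [mem_projE, mem_union, mem_image]
    constructor
    · rintro ⟨x, hx, rfl⟩
      by_cases hex : e ∈ x
      · exact Or.inr ⟨x, mem_filter.2 ⟨hx, hex⟩, rfl⟩
      · rw [erase_eq_of_notMem hex]
        exact Or.inl (mem_filter.2 ⟨hx, hex⟩)
    · rintro (hz | ⟨x, hx, rfl⟩)
      · exact ⟨z, (mem_filter.1 hz).1, erase_eq_of_notMem (mem_filter.1 hz).2⟩
      · exact ⟨x, (mem_filter.1 hx).1, rfl⟩
  have himgcard : (A1.image fun x => x.erase e).card = A1.card :=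
    card_image_of_injOn fun x hx y hy h => erase_injOn' e (mem_filter.1 hx).2 (mem_filter.1 hy).2 h
  -- the intersection of the two pieces is the partner family
  have hinter : A0 ∩ A1.image (fun x => x.erase e) = partE e A i := by
    ext z
    rw [mem_inter, mem_partE, mem_image]
    constructor
    · rintro ⟨hz, x, hx, rfl⟩
      obtain ⟨hzA, hez⟩ := mem_filter.1 hz
      obtain ⟨hxA, hex⟩ := mem_filter.1 hx
      exact ⟨hzA, hez, by rwa [insert_erase hex]⟩
    · rintro ⟨hzA, hez, hzeA⟩
      exact ⟨mem_filter.2 ⟨hzA, hez⟩, insert e z, mem_filter.2 ⟨hzeA, mem_insert_self e z⟩,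
        erase_insert hez⟩
  rw [himg, ← hinter, card_union_add_card_inter, himgcard, hcard]

end ProjCount

section Validity

variable {U : Finset α} {e : α} {A : ι → Finset (Finset α)}

omit [Fintype α] [DecidableEq ι] [Fintype ι] in
/-- The partner classes are inside the classes. -/
theorem partE_subset (i : ι) : partE e A i ⊆ A i := filter_subset _ _

omit [Fintype α] [DecidableEq ι] [Fintype ι] in
/-- **The partner instance of a valid instance is valid** (relative to `U ∖ e`). -/
theorem multiValidRel_partE (hU : e ∈ U) (hv : MultiValidRel U A) :
    MultiValidRel (U.erase e) (partE e A) := by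
  obtain ⟨hsub, hself, hcross⟩ := hv
  -- a relative complement in `U ∖ e` of a partner lifts to a relative complement in `U`
  have key : ∀ i j, ∀ z ∈ partE e A i, ∀ w ∈ partE e A j, (U.erase e) \ w = z →
      insert e z ∈ A i ∧ insert e z ∈ complsRel U (A j) := by
    intro i j z hz w hw hzw
    obtain ⟨-, -, hzeA⟩ := mem_partE.1 hz
    obtain ⟨hwA, hew, -⟩ := mem_partE.1 hw
    refine ⟨hzeA, mem_complsRel.2 ⟨w, hwA, ?_⟩⟩
    rw [← hzw]
    ext a
    simp only [mem_sdiff, mem_insert, mem_erase]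
    constructor
    · rintro ⟨ha, haw⟩
      by_cases hae : a = e
      · exact Or.inl hae
      · exact Or.inr ⟨⟨hae, ha⟩, haw⟩
    · rintro (rfl | ⟨⟨-, ha⟩, haw⟩)
      · exact ⟨hU, hew⟩
      · exact ⟨ha, haw⟩
  refine ⟨?_, ?_, ?_⟩
  · intro i z hz
    obtain ⟨hzA, hez, -⟩ := mem_partE.1 hz
    intro a ha
    exact mem_erase.2 ⟨fun h => hez (h ▸ ha), hsub i z hzA ha⟩
  · intro i
    rw [disjoint_left]
    intro z hz hzc
    obtain ⟨w, hw, hzw⟩ := mem_complsRel.1 hzc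
    obtain ⟨h1, h2⟩ := key i i z hz w hw hzw
    exact disjoint_left.1 (hself i) h1 h2
  · intro i j hij
    refine ⟨disjoint_of_subset_left (partE_subset i)
      (disjoint_of_subset_right (partE_subset j) (hcross i j hij).1), ?_⟩
    rw [disjoint_left]
    intro z hz hzc
    obtain ⟨w, hw, hzw⟩ := mem_complsRel.1 hzc
    obtain ⟨h1, h2⟩ := key i j z hz w hw hzw
    exact disjoint_left.1 (hcross i j hij).2 h1 h2

omit [Fintype α] [DecidableEq ι] [Fintype ι] in
/-- **The projected instance of a valid instance is valid exactly at a label-consistent point.** -/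
theorem multiValidRel_projE (hv : MultiValidRel U A) (hc : ConsistentAt U e A) :
    MultiValidRel (U.erase e) (projE e A) := by
  obtain ⟨hsub, -, hcross⟩ := hv
  obtain ⟨hc1, hc2⟩ := hc
  refine ⟨?_, ?_, ?_⟩
  · intro i z hz
    obtain ⟨x, hx, rfl⟩ := mem_projE.1 hz
    intro a ha
    rw [mem_erase] at ha ⊢
    exact ⟨ha.1, hsub i x hx ha.2⟩
  · intro i
    rw [disjoint_left]
    intro z hz hzc
    obtain ⟨x, hx, rfl⟩ := mem_projE.1 hz
    obtain ⟨w, hw, hzw⟩ := mem_complsRel.1 hzc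
    obtain ⟨y, hy, rfl⟩ := mem_projE.1 hw
    exact hc2 i i y hy x hx hzw
  · intro i j hij
    refine ⟨?_, ?_⟩
    · rw [disjoint_left]
      intro z hz hz'
      obtain ⟨x, hx, rfl⟩ := mem_projE.1 hz
      obtain ⟨y, hy, hxy⟩ := mem_projE.1 hz'
      exact hij (hc1 i j x hx y hy hxy.symm)
    · rw [disjoint_left]
      intro z hz hzc
      obtain ⟨x, hx, rfl⟩ := mem_projE.1 hz
      obtain ⟨w, hw, hzw⟩ := mem_complsRel.1 hzc
      obtain ⟨y, hy, rfl⟩ := mem_projE.1 hw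
      exact hc2 j i y hy x hx hzw

end Validity

end PercRepro.MSTight
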